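import Mathlib
import HarnessLib
import Literature.Analysis.Calculus.IteratedFDerivSymmetric
import Summits.NavierStokesRegularity.NavierStokesRegularity.Theorems.PoloidalWindowDoorLrcModEntireCurvedSheetUniqueness
import Summits.NavierStokesRegularity.NavierStokesRegularity.Theorems.PoloidalWindowDoorLrcModEntireGraphTransport

/-!
# Route `PoloidalWindowDoor`, item `LrcModEntire` (stmt-NavierStokesRegularity-20428), cell (Q4-sonic, straight, μ < 0) `stub_Q4sonicLineNeg`, case II —
# CAUCHY–KOVALEVSKAYA UNIQUENESS ACROSS AN `s`-MODULATED GRAPH SHEET (frame-free jet induction in graph coordinates over the line)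

Cell ns-regularity-ideate, stub-worker seat ns-poloidal-K2-p2 g18 under the LEAD of item 20428 (ns-poloidal-K2-p3 g17/g18);
`--supports stmt-NavierStokesRegularity-20428 --as helper`.  Memo `Cruxes/LrcModEntire/T2B-g17.md` §5(5f)/§12 and the LEAD word 2026-08-29T23:01:43Z (v15:
«periodic curvature modulation at SOME non-sonic τ» is closable by porting the (Q4-curved-periodic) Cauchy–Kovalevskaya lever to time `−1+τ`).  At a non-sonic time
the webs of the case-II object are NOT parallel curves of a fixed branch in a Fermi frame handed to us — they are the GRAPHS `n = G(s,z)` of the space–time web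
function over the straight hot line; this file is the graph-coordinate twin of this seat's `…CurvedSheetUniqueness` (g16, Fermi frame of a curved branch).

Setting (class-free): `w : ℝ³ → ℝ` real-analytic with the slice law `∂₂²w = −μ(x₂)Δₕw` on the slab `{x₂ ∈ I}`; `e` a horizontal unit vector, `Je = Jvec e`;
`G` differentiable on the region `ℝ × I`; the GRAPH SHEET `W(s,z) = s·e + G(s,z)·Je + z·e₂` (`webMap e G`); zero Cauchy data `w(W) = 0`, `Dw(W) = 0` on the
region; and the sheet NON-characteristic: `G_z² + μ(z)(1 + G_s²) ≠ 0`.  Then: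

* `iteratedFDeriv_eq_zero_on_graphSheet` — every jet of `w` vanishes on the sheet.  JET INDUCTION as in `…CurvedSheetUniqueness`: tangential derivatives along
  `W_s = e + G_s·Je`, `W_z = G_z·Je + e₂` of vanishing jets vanish (slot symmetry `Literature…iteratedFDeriv_apply_perm_of_le`); the slice law along the normal
  line `m ↦ W + m·Je` (on which `μ` is constant), differentiated `n` times, gives after the expansions `e₂ = W_z − G_z·Je`, `eᵢ = ⟪eᵢ,e⟫W_s + (⟪eᵢ,Je⟫ − G_s⟪eᵢ,e⟫)Je`
  the relation `(G_z² + μ(1 + G_s²))·Dⁿ⁺²w(W)[Je,…,Je] = 0`; then `multilinear_eq_zero_of_slots` in the frame `(W_s, W_z, Je)`.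
* ★ `eqOn_zero_nhds_of_graphSheet` — hence `w = 0` near every sheet point (Taylor series of the analytic `w`).

Consumer (next file, this seat): the PERIODIC-SHEET sub-case of case II of `stub_Q4sonicLineNeg` at a non-sonic time `−1+τ`: an `s`-period `L·e` of the
web sheet makes `w = U₂(−1+τ, · + L·e) − U₂(−1+τ, ·)` vanish near a non-characteristic height (`R_zz(τ,z) ≠ 0` by the Huygens identity), and
`…HorizontalPeriodAtTime.false_of_local_horizontalPeriod_shift` ends it.
WHAT THIS IS NOT: not a claim about Navier–Stokes regularity; class-free analysis for the research residue `stub_Q4sonicLineNegIsolated`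
(bears_on LADDER-NS N0 via item 20428; items 20428 / 19708 / 27893 OPEN).
-/

noncomputable section

-- the summit and its single sub-problem share the name (CONVENTIONS §1), as in every Theorems file
set_option linter.dupNamespace false

namespace Summit.NavierStokesRegularity.NavierStokesRegularity.Theorems.PoloidalWindowDoorLrcModEntireGraphSheetUniqueness

open Set Function Filter Topology
open scoped InnerProductSpace RealInnerProductSpace ContDiff
open Summit.NavierStokesRegularity.NavierStokesRegularity.Theorems.PoloidalWindowDoorLrcModEntireSheetFlattenTools
open Summit.NavierStokesRegularity.NavierStokesRegularity.Theorems.PoloidalWindowDoorLrcModEntireParallelWebsIdentity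
open Summit.NavierStokesRegularity.NavierStokesRegularity.Theorems.PoloidalWindowDoorLrcModEntireRidgeGlobalBranchODE
open Summit.NavierStokesRegularity.NavierStokesRegularity.Theorems.PoloidalWindowDoorLrcModEntireRidgeGlobalBranchFrame
open Summit.NavierStokesRegularity.NavierStokesRegularity.Theorems.PoloidalWindowDoorLrcModEntireCurvedWebHuygens
open Summit.NavierStokesRegularity.NavierStokesRegularity.Theorems.PoloidalWindowDoorLrcModEntireCurvedSheetUniqueness
open Summit.NavierStokesRegularity.NavierStokesRegularity.Theorems.PoloidalWindowDoorLrcModEntireGraphTransport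

/-! ### A. The graph frame `(e + G_s·Je, G_z·Je + e₂, Je)` -/

/-- Decomposition of any vector in the graph frame `(e + a·Je, b·Je + e₂, Je)` of a horizontal unit vector `e`. -/
theorem decomp_graphFrame {e : EuclideanSpace ℝ (Fin 3)} (he2 : e 2 = 0) (hun : ‖e‖ = 1) (a b : ℝ) (u : EuclideanSpace ℝ (Fin 3)) :
    u = ⟪u, e⟫ • (e + a • rotJ e) + (u 2) • (b • rotJ e + e2) + (⟪u, rotJ e⟫ - a * ⟪u, e⟫ - b * u 2) • rotJ e := by
  have hab := sq_add_sq_of_horizontal_unit he2 hun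
  ext i
  fin_cases i
  · simp [inner_eq_sum3, rotJ, e2, he2]
    linear_combination (-(u 0)) * hab
  · simp [inner_eq_sum3, rotJ, e2, he2]
    linear_combination (-(u 1)) * hab
  · simp [inner_eq_sum3, rotJ, e2, he2]

/-- For a horizontal unit `e` and `ν = rotJ e`: `∑ᵢ₌₀,₁ (⟪eᵢ,ν⟫ − a⟪eᵢ,e⟫)² = 1 + a²`. -/
theorem sum_sq_graphFrame {e : EuclideanSpace ℝ (Fin 3)} (he2 : e 2 = 0) (hun : ‖e‖ = 1) (a : ℝ) :
    (⟪(e0 : EuclideanSpace ℝ (Fin 3)), rotJ e⟫ - a * ⟪(e0 : EuclideanSpace ℝ (Fin 3)), e⟫) ^ 2 +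
        (⟪(e1 : EuclideanSpace ℝ (Fin 3)), rotJ e⟫ - a * ⟪(e1 : EuclideanSpace ℝ (Fin 3)), e⟫) ^ 2 = 1 + a ^ 2 := by
  have hab := sq_add_sq_of_horizontal_unit he2 hun
  rw [inner_eq_sum3, inner_eq_sum3, inner_eq_sum3, inner_eq_sum3]
  simp [e0, e1, rotJ]
  linear_combination (1 + a ^ 2) * hab

/-! ### B. The jet induction on the graph sheet -/

section sheet

variable {w : EuclideanSpace ℝ (Fin 3) → ℝ} {I : Set ℝ} {μ : ℝ → ℝ} {G : ℝ × ℝ → ℝ} {e : EuclideanSpace ℝ (Fin 3)}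

/-- ★ **ALL JETS OF `w` VANISH ON A NON-CHARACTERISTIC GRAPH SHEET carrying zero Cauchy data.**  See the module docstring. -/
theorem iteratedFDeriv_eq_zero_on_graphSheet (hw : AnalyticOnNhd ℝ w univ) (hI : IsOpen I)
    (hG : ∀ p ∈ region I, DifferentiableAt ℝ G p) (he2 : e 2 = 0) (hun : ‖e‖ = 1)
    (hlaw : ∀ x : EuclideanSpace ℝ (Fin 3), x 2 ∈ I →
      fderiv ℝ (fun y => fderiv ℝ w y (EuclideanSpace.single 2 (1 : ℝ))) x (EuclideanSpace.single 2 (1 : ℝ)) =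
        -μ (x 2) * (fderiv ℝ (fun y => fderiv ℝ w y (EuclideanSpace.single 0 (1 : ℝ))) x (EuclideanSpace.single 0 (1 : ℝ)) +
          fderiv ℝ (fun y => fderiv ℝ w y (EuclideanSpace.single 1 (1 : ℝ))) x (EuclideanSpace.single 1 (1 : ℝ))))
    (h0 : ∀ p ∈ region I, w (webMap e G p) = 0)
    (h1 : ∀ p ∈ region I, fderiv ℝ w (webMap e G p) = 0)
    (hQ : ∀ p ∈ region I, (fderiv ℝ G p (0, 1)) ^ 2 + μ p.2 * (1 + (fderiv ℝ G p (1, 0)) ^ 2) ≠ 0) :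
    ∀ (N : ℕ), ∀ p ∈ region I, ∀ v : Fin N → EuclideanSpace ℝ (Fin 3), iteratedFDeriv ℝ N w (webMap e G p) v = 0 := by
  have hwi : ContDiff ℝ ∞ w := hw.contDiff
  have hw2 : ContDiff ℝ 2 w := hw.contDiff
  -- the claim for two consecutive orders, by induction
  suffices key : ∀ n : ℕ, (∀ p ∈ region I, ∀ v : Fin n → EuclideanSpace ℝ (Fin 3), iteratedFDeriv ℝ n w (webMap e G p) v = 0) ∧
      (∀ p ∈ region I, ∀ v : Fin (n + 1) → EuclideanSpace ℝ (Fin 3), iteratedFDeriv ℝ (n + 1) w (webMap e G p) v = 0) by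
    intro N; exact (key N).1
  intro n
  induction n with
  | zero =>
    refine ⟨fun p hp v => ?_, fun p hp v => ?_⟩
    · rw [iteratedFDeriv_zero_apply]; exact h0 p hp
    · rw [iteratedFDeriv_one_apply, h1 p hp]; rfl
  | succ n ih =>
    obtain ⟨ihn, ihn1⟩ := ih
    refine ⟨ihn1, fun p hp v => ?_⟩
    -- ### the step: the `(n+2)`-jet at the sheet point `x = W(p)`
    set x : EuclideanSpace ℝ (Fin 3) := webMap e G p with hx
    set ν : EuclideanSpace ℝ (Fin 3) := rotJ e with hνdef
    set Gs : ℝ := fderiv ℝ G p (1, 0) with hGs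
    set Gz : ℝ := fderiv ℝ G p (0, 1) with hGz
    set M := iteratedFDeriv ℝ (n + 2) w x with hM
    set T : EuclideanSpace ℝ (Fin 3) := e + Gs • ν with hTdef
    set τz : EuclideanSpace ℝ (Fin 3) := Gz • ν + e2 with hτz
    have hν2 : ν 2 = 0 := (rotJ_facts he2 hun).1
    have hνu : ‖ν‖ = 1 := (rotJ_facts he2 hun).2.1
    have hJe : Jvec e = ν := by rw [hνdef]; exact Jvec_eq_rotJ e
    -- (i) tangential vanishing in slot 0
    have htan : ∀ (v' : Fin (n + 1) → EuclideanSpace ℝ (Fin 3)) (h : ℝ × ℝ),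
        M (Fin.cons (h.1 • e + (fderiv ℝ G p h) • ν + h.2 • e2) v') = 0 := by
      intro v' h
      have hzero : ∀ q ∈ region I, (fun q : ℝ × ℝ => iteratedFDeriv ℝ (n + 1) w (webMap e G q) v') q = 0 :=
        fun q hq => ihn1 q hq v'
      have hh := fderiv_eq_zero_of_eqOn_region hI hzero hp h
      have hg : DifferentiableAt ℝ (fun y => iteratedFDeriv ℝ (n + 1) w y v') (webMap e G p) :=
        ((hwi.differentiable_iteratedFDeriv (m := n + 1) (by exact_mod_cast ENat.coe_lt_top _)) _).continuousMultilinear_apply_const v'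
      rw [fderiv_comp_webMap e (hG p hp) hg, fderiv_iteratedFDeriv_apply hwi, hJe] at hh
      simpa [hM, hx] using hh
    have hconsT : ∀ v' : Fin (n + 1) → EuclideanSpace ℝ (Fin 3), M (Fin.cons T v') = 0 := by
      intro v'
      have h := htan v' (1, 0)
      simp only [one_smul, zero_smul, add_zero] at h
      simpa [hTdef, hGs] using h
    have hconsZ : ∀ v' : Fin (n + 1) → EuclideanSpace ℝ (Fin 3), M (Fin.cons τz v') = 0 := by
      intro v'
      have h := htan v' (0, 1)
      simp only [zero_smul, zero_add, one_smul] at h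
      simpa [hτz, hGz] using h
    -- (i') symmetry: the same in every slot
    have hperm : ∀ (u : Fin (n + 2) → EuclideanSpace ℝ (Fin 3)) (σ : Equiv.Perm (Fin (n + 2))), M (fun j => u (σ j)) = M u :=
      fun u σ => Literature.Analysis.Calculus.iteratedFDeriv_apply_perm_of_le ((hw x (mem_univ x)).contDiffAt) le_top u σ
    have hslot : ∀ (a : EuclideanSpace ℝ (Fin 3)), (∀ v', M (Fin.cons a v') = 0) →
        ∀ (u : Fin (n + 2) → EuclideanSpace ℝ (Fin 3)) (i : Fin (n + 2)), M (update u i a) = 0 := by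
      intro a hcons u i
      set u' := update u i a with hu'
      have h := hperm u' (Equiv.swap 0 i)
      rw [← h]
      have e : (fun j => u' ((Equiv.swap 0 i) j)) = Fin.cons a (Fin.tail fun j => u' ((Equiv.swap 0 i) j)) := by
        rw [← Fin.cons_self_tail (fun j => u' ((Equiv.swap 0 i) j))]
        congr 1
        simp [hu']
      rw [e]
      exact hcons _
    have ha := hslot T hconsT
    have hb := hslot τz hconsZ
    -- (ii) the slice law along the normal line `m ↦ x + m•ν`
    set c₀ : ℝ := M (fun _ => ν) with hc₀
    have hDD : ∀ (a b : EuclideanSpace ℝ (Fin 3)) (m : ℝ), fderiv ℝ (fun y => fderiv ℝ w y b) (x + m • ν) a = fderiv ℝ (fderiv ℝ w) (x + m • ν) a b :=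
      fun a b m => nested_eq_fderiv_fderiv hw2 _ a b
    have hx2 : x 2 = p.2 := by rw [hx]; exact webMap_apply_two he2 G p
    have hxm2 : ∀ m : ℝ, (x + m • ν) 2 = p.2 := fun m => by simp [hν2, hx2]
    have hline0 : ∀ m : ℝ, fderiv ℝ (fderiv ℝ w) (x + m • ν) e2 e2 =
        -μ p.2 * (fderiv ℝ (fderiv ℝ w) (x + m • ν) e0 e0 + fderiv ℝ (fderiv ℝ w) (x + m • ν) e1 e1) := by
      intro m
      have h := hlaw (x + m • ν) (by rw [hxm2]; exact hp)
      rw [hDD, hDD, hDD, hxm2] at h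
      exact h
    -- the three line functions and their `n`-th derivatives
    have hgu : ∀ u : EuclideanSpace ℝ (Fin 3), ContDiff ℝ ∞ (fun y => fderiv ℝ (fderiv ℝ w) y u u) := fun u =>
      ((hwi.fderiv_right (m := ∞) (by simp)).fderiv_right (m := ∞) (by simp)).clm_apply contDiff_const |>.clm_apply contDiff_const
    have hφ : ∀ u : EuclideanSpace ℝ (Fin 3), ContDiff ℝ ∞ (fun m : ℝ => fderiv ℝ (fderiv ℝ w) (x + m • ν) u u) := fun u =>
      (hgu u).comp (contDiff_const.add (contDiff_id.smul contDiff_const))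
    have hNu : ∀ u : EuclideanSpace ℝ (Fin 3), iteratedDeriv n (fun m : ℝ => fderiv ℝ (fderiv ℝ w) (x + m • ν) u u) 0 =
        M (Fin.snoc (Fin.snoc (fun _ : Fin n => ν) u) u) := by
      intro u
      rw [iteratedDeriv_line (hgu u), iteratedFDeriv_hessian_apply hwi]
    have hPDE : M (Fin.snoc (Fin.snoc (fun _ : Fin n => ν) e2) e2) =
        -μ p.2 * (M (Fin.snoc (Fin.snoc (fun _ : Fin n => ν) e0) e0) + M (Fin.snoc (Fin.snoc (fun _ : Fin n => ν) e1) e1)) := by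
      have hfun : (fun m : ℝ => fderiv ℝ (fderiv ℝ w) (x + m • ν) e2 e2) =
          fun m => -μ p.2 * (((fun m : ℝ => fderiv ℝ (fderiv ℝ w) (x + m • ν) e0 e0) + (fun m : ℝ => fderiv ℝ (fderiv ℝ w) (x + m • ν) e1 e1)) m) := by
        funext m; simp only [Pi.add_apply]; exact hline0 m
      rw [← hNu, ← hNu, ← hNu, hfun, iteratedDeriv_const_mul_field,
        iteratedDeriv_add ((hφ e0).contDiffAt.of_le (by exact_mod_cast le_top)) ((hφ e1).contDiffAt.of_le (by exact_mod_cast le_top))]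
    -- (ii') expansion of the last two slots
    set r : Fin n → EuclideanSpace ℝ (Fin 3) := fun _ => ν with hr
    have hlast_b : ∀ (q : Fin (n + 1) → EuclideanSpace ℝ (Fin 3)), M (Fin.snoc q τz) = 0 := by
      intro q
      have h := hb (Fin.snoc q τz) (Fin.last _)
      rwa [update_eq_self_iff.2 (Fin.snoc_last _ _).symm] at h
    have hlast_a : ∀ (q : Fin (n + 1) → EuclideanSpace ℝ (Fin 3)), M (Fin.snoc q T) = 0 := by
      intro q
      have h := ha (Fin.snoc q T) (Fin.last _)
      rwa [update_eq_self_iff.2 (Fin.snoc_last _ _).symm] at h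
    have hswap : ∀ a b : EuclideanSpace ℝ (Fin 3), M (Fin.snoc (Fin.snoc r a) b) = M (Fin.snoc (Fin.snoc r b) a) := by
      intro a b
      have h := hperm (Fin.snoc (Fin.snoc r a) b) (Equiv.swap (Fin.last (n + 1)) (Fin.castSucc (Fin.last n)))
      rw [← h]
      congr 1
      funext j
      by_cases hj1 : j = Fin.last (n + 1)
      · subst hj1
        simp [Equiv.swap_apply_left, Fin.snoc_last, Fin.snoc_castSucc]
      · by_cases hj2 : j = Fin.castSucc (Fin.last n)
        · subst hj2
          simp [Equiv.swap_apply_right, Fin.snoc_last, Fin.snoc_castSucc]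
        · rw [Equiv.swap_apply_of_ne_of_ne hj1 hj2]
          -- `j` is one of the first `n` slots: both sides are `ν`
          obtain ⟨j', rfl⟩ : ∃ j' : Fin (n + 1), j = Fin.castSucc j' := by
            rcases Fin.eq_castSucc_or_eq_last j with ⟨j', hj'⟩ | hj'
            · exact ⟨j', hj'⟩
            · exact absurd hj' hj1
          have hj3 : j' ≠ Fin.last n := fun h => hj2 (by rw [h])
          obtain ⟨j'', rfl⟩ : ∃ j'' : Fin n, j' = Fin.castSucc j'' := by
            rcases Fin.eq_castSucc_or_eq_last j' with ⟨j'', hj''⟩ | hj''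
            · exact ⟨j'', hj''⟩
            · exact absurd hj'' hj3
          simp [Fin.snoc_castSucc, hr]
    have hlin : ∀ (q : Fin (n + 1) → EuclideanSpace ℝ (Fin 3)) (a b : EuclideanSpace ℝ (Fin 3)) (α β : ℝ),
        M (Fin.snoc q (α • a + β • b)) = α * M (Fin.snoc q a) + β * M (Fin.snoc q b) := by
      intro q a b α β
      have e : ∀ u : EuclideanSpace ℝ (Fin 3), (Fin.snoc q u : Fin (n + 2) → EuclideanSpace ℝ (Fin 3)) =
          update (Fin.snoc q (0 : EuclideanSpace ℝ (Fin 3))) (Fin.last (n + 1)) u := fun u => by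
        rw [Fin.update_snoc_last]
      rw [e (α • a + β • b), e a, e b, M.map_update_add, M.map_update_smul, M.map_update_smul, smul_eq_mul, smul_eq_mul]
    -- `N(a, e₂) = −G_z N(a, ν)` and `N(a, eᵢ) = (⟪eᵢ,ν⟫ − G_s⟪eᵢ,e⟫) N(a, ν)`
    have hNe2 : ∀ a, M (Fin.snoc (Fin.snoc r a) e2) = -Gz * M (Fin.snoc (Fin.snoc r a) ν) := by
      intro a
      have he : (e2 : EuclideanSpace ℝ (Fin 3)) = (1 : ℝ) • τz + (-Gz) • ν := by
        simp only [hτz, one_smul]; module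
      rw [he, hlin, hlast_b, mul_zero, zero_add]
    have hNei : ∀ (a e' : EuclideanSpace ℝ (Fin 3)), e' 2 = 0 →
        M (Fin.snoc (Fin.snoc r a) e') = (⟪e', ν⟫ - Gs * ⟪e', e⟫) * M (Fin.snoc (Fin.snoc r a) ν) := by
      intro a e' he'
      have hexp := horiz_expand he' he2 hun
      have hexp' : e' = ⟪e', e⟫ • T + (⟪e', ν⟫ - Gs * ⟪e', e⟫) • ν := by
        rw [hTdef, hνdef]
        have h0 := hexp
        calc e' = ⟪e', e⟫ • e + ⟪e', rotJ e⟫ • rotJ e := h0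
          _ = ⟪e', e⟫ • (e + Gs • rotJ e) + (⟪e', rotJ e⟫ - Gs * ⟪e', e⟫) • rotJ e := by module
      conv_lhs => rw [hexp']
      rw [hlin, hlast_a, mul_zero, zero_add]
    have hrνν : (Fin.snoc (Fin.snoc r ν) ν : Fin (n + 2) → EuclideanSpace ℝ (Fin 3)) = fun _ => ν := by
      rw [hr, snoc_const, snoc_const]
    have hN22 : M (Fin.snoc (Fin.snoc r e2) e2) = Gz ^ 2 * c₀ := by
      rw [hNe2, hswap, hNe2, hrνν, hc₀]; ring
    have hNii : ∀ e' : EuclideanSpace ℝ (Fin 3), e' 2 = 0 →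
        M (Fin.snoc (Fin.snoc r e') e') = (⟪e', ν⟫ - Gs * ⟪e', e⟫) ^ 2 * c₀ := by
      intro e' he'
      rw [hNei e' e' he', hswap, hNei ν e' he', hrνν, hc₀]; ring
    have hsum : (⟪(e0 : EuclideanSpace ℝ (Fin 3)), ν⟫ - Gs * ⟪(e0 : EuclideanSpace ℝ (Fin 3)), e⟫) ^ 2 +
        (⟪(e1 : EuclideanSpace ℝ (Fin 3)), ν⟫ - Gs * ⟪(e1 : EuclideanSpace ℝ (Fin 3)), e⟫) ^ 2 = 1 + Gs ^ 2 := by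
      rw [hνdef]; exact sum_sq_graphFrame he2 hun Gs
    have hc₀0 : c₀ = 0 := by
      have h := hPDE
      rw [hN22, hNii e0 (by simp [e0]), hNii e1 (by simp [e1])] at h
      have h2 : (Gz ^ 2 + μ p.2 * (1 + Gs ^ 2)) * c₀ = 0 := by linear_combination h - μ p.2 * c₀ * hsum
      rcases mul_eq_zero.1 h2 with h3 | h3
      · exact absurd h3 (hQ p hp)
      · exact h3
    -- (iii) multilinear expansion
    have hdec : ∀ u : EuclideanSpace ℝ (Fin 3), ∃ α β γ : ℝ, u = α • T + β • τz + γ • ν := fun u =>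
      ⟨⟪u, e⟫, u 2, ⟪u, rotJ e⟫ - Gs * ⟪u, e⟫ - Gz * u 2, by rw [hτz, hνdef, hTdef]; exact decomp_graphFrame he2 hun Gs Gz u⟩
    exact multilinear_eq_zero_of_slots M ha hb (by rw [← hc₀]; exact hc₀0) hdec v

/-- ★ **CK UNIQUENESS ACROSS AN `s`-MODULATED NON-CHARACTERISTIC GRAPH SHEET**: under the hypotheses of `iteratedFDeriv_eq_zero_on_graphSheet`, `w` vanishes
on a neighbourhood of every sheet point (Taylor expansion of the analytic `w`). -/
theorem eqOn_zero_nhds_of_graphSheet (hw : AnalyticOnNhd ℝ w univ) (hI : IsOpen I)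
    (hG : ∀ p ∈ region I, DifferentiableAt ℝ G p) (he2 : e 2 = 0) (hun : ‖e‖ = 1)
    (hlaw : ∀ x : EuclideanSpace ℝ (Fin 3), x 2 ∈ I →
      fderiv ℝ (fun y => fderiv ℝ w y (EuclideanSpace.single 2 (1 : ℝ))) x (EuclideanSpace.single 2 (1 : ℝ)) =
        -μ (x 2) * (fderiv ℝ (fun y => fderiv ℝ w y (EuclideanSpace.single 0 (1 : ℝ))) x (EuclideanSpace.single 0 (1 : ℝ)) +
          fderiv ℝ (fun y => fderiv ℝ w y (EuclideanSpace.single 1 (1 : ℝ))) x (EuclideanSpace.single 1 (1 : ℝ))))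
    (h0 : ∀ p ∈ region I, w (webMap e G p) = 0)
    (h1 : ∀ p ∈ region I, fderiv ℝ w (webMap e G p) = 0)
    (hQ : ∀ p ∈ region I, (fderiv ℝ G p (0, 1)) ^ 2 + μ p.2 * (1 + (fderiv ℝ G p (1, 0)) ^ 2) ≠ 0)
    {p : ℝ × ℝ} (hp : p ∈ region I) :
    ∀ᶠ y in 𝓝 (webMap e G p), w y = 0 := by
  set x := webMap e G p with hx
  have hjet := iteratedFDeriv_eq_zero_on_graphSheet hw hI hG he2 hun hlaw h0 h1 hQ
  obtain ⟨q, r, hq⟩ := hw x (mem_univ x)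
  have hr : 0 < r := hq.r_pos
  have hball : ∀ y ∈ Metric.eball x r, w y = 0 := by
    intro y hy
    have hy' : y - x ∈ Metric.eball (0 : EuclideanSpace ℝ (Fin 3)) r := by
      rw [Metric.mem_eball, edist_eq_enorm_sub, sub_zero]; rw [Metric.mem_eball, edist_eq_enorm_sub] at hy; exact hy
    have hsum := hq.hasSum_iteratedFDeriv hy'
    have hzero : (fun n => ((Nat.factorial n : ℝ))⁻¹ • iteratedFDeriv ℝ n w x fun _ => y - x) = fun _ => 0 := by
      funext n
      rw [hjet n p hp, smul_zero]
    rw [hzero, add_sub_cancel] at hsum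
    exact (hsum.unique hasSum_zero)
  exact Filter.eventually_of_mem (Metric.eball_mem_nhds x hr) hball

end sheet

end Summit.NavierStokesRegularity.NavierStokesRegularity.Theorems.PoloidalWindowDoorLrcModEntireGraphSheetUniqueness
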